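import Mathlib

/-!
# Exponent bookkeeping behind the dead-line report `Lines/coset-difference-hermite-lindemann.md`
(crux `stmt-Schanuel-1050`, decl `Summit.Schanuel.Schanuel.Theses.RoyCriterion.RoySmallValueDirichletGap`)

Crux-plan seat `planner-cruxplan-stmt-Schanuel-1050-coset-difference-her-0`, 2026-08-15.
This file is NOT a skeleton line (no `stub_*`, no `RoySmallValueDirichletGap_of`): it kernel-checks the
real-closed-field facts quoted in the report. Notation (Roy 2013 = arXiv:1301.0663 §7, with
`δ := ν − (2 + β − τ) > 0`, `1 < τ < 2`, `β > τ`):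

* `b τ δ = 1 − δ/(τ−1)` — level exponent, `D* ≪ D^b` (tree: `Roy2013.endgame_step`, first conjunct);
* `e β τ δ = (2−τ) − δ(1+β−τ)/(τ−1)` — enemy-degree exponent, `deg Z_D ≪ D^e` (from both conjuncts);
* `δR β τ = (τ−1)(2−τ)/(β+1−τ)` — Roy's printed correction (`e(δR) = 0`);
* `Eorb = e + b(1+β−τ)` — exponent of `deg Z · h(Z)`, the orbit's counting entropy;
* `δcount = (3−2τ)(τ−1)/(1+2β−τ)` — below it a single hugging point (or a pair) is generic by counting;
* `δpair = (7−4τ)(τ−1)/(3+4β−3τ)` — below it even a counting-sharp pair measure `Φ ≍ D_K² h` fails;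
* `δHP = (3−τ)(τ−1)/(1+2β−τ)` — threshold of the explicit one-pair Hermite–Padé/Liouville version.
-/

namespace CosetDifferenceExponents

noncomputable def b (τ δ : ℝ) : ℝ := 1 - δ / (τ - 1)
noncomputable def e (β τ δ : ℝ) : ℝ := (2 - τ) - δ * (1 + β - τ) / (τ - 1)
noncomputable def δR (β τ : ℝ) : ℝ := (τ - 1) * (2 - τ) / (β + 1 - τ)
noncomputable def Eorb (β τ δ : ℝ) : ℝ := e β τ δ + b τ δ * (1 + β - τ)
noncomputable def δcount (β τ : ℝ) : ℝ := (3 - 2 * τ) * (τ - 1) / (1 + 2 * β - τ)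
noncomputable def δpair (β τ : ℝ) : ℝ := (7 - 4 * τ) * (τ - 1) / (3 + 4 * β - 3 * τ)
noncomputable def δHP (β τ : ℝ) : ℝ := (3 - τ) * (τ - 1) / (1 + 2 * β - τ)

variable {β τ δ : ℝ}

/-- Roy's threshold is exactly where the enemy degree exponent vanishes. -/
theorem e_δR (h1 : 1 < τ) (hβ : τ < β) : e β τ (δR β τ) = 0 := by
  unfold e δR
  have hτ : τ - 1 ≠ 0 := by intro h; linarith
  have hb : β + 1 - τ ≠ 0 := by intro h; linarith
  field_simp
  ring

/-- `δR > 0` on the open range. -/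
theorem δR_pos (h1 : 1 < τ) (h2 : τ < 2) (hβ : τ < β) : 0 < δR β τ := by
  unfold δR
  exact div_pos (mul_pos (by linarith) (by linarith)) (by linarith)

/-- The orbit entropy exponent in closed form. -/
theorem Eorb_eq (h1 : 1 < τ) :
    Eorb β τ δ = (3 + β - 2 * τ) - 2 * δ * (1 + β - τ) / (τ - 1) := by
  unfold Eorb e b
  have hτ : τ - 1 ≠ 0 := by intro h; linarith
  field_simp
  ring

theorem Eorb_sub (h1 : 1 < τ) :
    Eorb β τ δ - (δ + β) = ((3 - 2 * τ) * (τ - 1) - δ * (1 + 2 * β - τ)) / (τ - 1) := by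
  unfold Eorb e b
  have hτ : τ - 1 ≠ 0 := by intro h; linarith
  field_simp
  ring

/-- **(i) Single-point / two-point counting threshold.** The enemy profile `(deg Z, h(Z), ε)` with
`log(1/ε) ≍ D^{δ+β}` is generic (expected to exist by counting, entropy `≍ deg Z · h(Z) ≍ D^{Eorb}`)
iff `δ + β < Eorb`, i.e. iff `δ (1+2β−τ) < (3−2τ)(τ−1)`, i.e. iff `δ < δcount` — possible only for
`τ < 3/2`. -/
theorem lt_Eorb_iff (h1 : 1 < τ) :
    δ + β < Eorb β τ δ ↔ δ * (1 + 2 * β - τ) < (3 - 2 * τ) * (τ - 1) := by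
  rw [← sub_pos, Eorb_sub h1, div_pos_iff_of_pos_right (by linarith : (0:ℝ) < τ - 1), sub_pos]

theorem lt_Eorb_iff' (h1 : 1 < τ) (hβ : τ < β) :
    δ + β < Eorb β τ δ ↔ δ < δcount β τ := by
  rw [lt_Eorb_iff h1, δcount, lt_div_iff₀ (by linarith : (0:ℝ) < 1 + 2 * β - τ)]

theorem δcount_pos_iff (h1 : 1 < τ) (hβ : τ < β) : 0 < δcount β τ ↔ τ < 3 / 2 := by
  unfold δcount
  rw [div_pos_iff_of_pos_right (by linarith : (0:ℝ) < 1 + 2 * β - τ)]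
  constructor
  · intro h
    by_contra hc
    push Not at hc
    have : (3 - 2 * τ) * (τ - 1) ≤ 0 := by nlinarith
    linarith
  · intro h
    exact mul_pos (by linarith) (by linarith)

/-- `δcount < δR` always (the difference of cross-products is `β − (τ−1)² > 0`). -/
theorem δcount_lt_δR (h1 : 1 < τ) (h2 : τ < 2) (hβ : τ < β) : δcount β τ < δR β τ := by
  unfold δcount δR
  have hA : (0:ℝ) < 1 + 2 * β - τ := by linarith
  have hB : (0:ℝ) < β + 1 - τ := by linarith
  rw [div_lt_div_iff₀ hA hB]
  have hτ : 0 < τ - 1 := by linarith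
  have key : (2 - τ) * (1 + 2 * β - τ) - (3 - 2 * τ) * (β + 1 - τ) = β - (τ - 1) ^ 2 := by ring
  have hpos : 0 < β - (τ - 1) ^ 2 := by nlinarith
  nlinarith [mul_pos hτ hpos, key]

theorem threeE_sub (h1 : 1 < τ) :
    (3 * e β τ δ + b τ δ * (1 + β - τ)) - (δ + β) =
      ((7 - 4 * τ) * (τ - 1) - δ * (3 + 4 * β - 3 * τ)) / (τ - 1) := by
  unfold e b
  have hτ : τ - 1 ≠ 0 := by intro h; linarith
  field_simp
  ring

/-- **(ii) Pair-measure ceiling.** A counting-sharp ("dream") approximation measure for the coset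
difference `(a, b) = (x − x′, y/y′)`, `Φ ≍ D_K² · h` with `D_K ≍ (deg Z)²`, `h ≍ h(Z)/deg Z`, has
exponent `3e + b(1+β−τ)`; it beats the smallness `D^{δ+β}` iff `δ (3+4β−3τ) > (7−4τ)(τ−1)`, i.e.
iff `δ > δpair` — at the Dirichlet edge only for `τ ≥ 7/4`. -/
theorem threeE_lt_iff (h1 : 1 < τ) :
    3 * e β τ δ + b τ δ * (1 + β - τ) < δ + β ↔ (7 - 4 * τ) * (τ - 1) < δ * (3 + 4 * β - 3 * τ) := by
  rw [← sub_neg, threeE_sub h1, div_neg_iff]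
  constructor
  · rintro (⟨_, h⟩ | ⟨h, _⟩)
    · linarith
    · linarith
  · intro h
    exact Or.inr ⟨by linarith, by linarith⟩

theorem threeE_lt_iff' (h1 : 1 < τ) (hβ : τ < β) :
    3 * e β τ δ + b τ δ * (1 + β - τ) < δ + β ↔ δpair β τ < δ := by
  rw [threeE_lt_iff h1, δpair, div_lt_iff₀ (by linarith : (0:ℝ) < 3 + 4 * β - 3 * τ)]

theorem δpair_pos_iff (h1 : 1 < τ) (hβ : τ < β) : 0 < δpair β τ ↔ τ < 7 / 4 := by
  unfold δpair
  rw [div_pos_iff_of_pos_right (by linarith : (0:ℝ) < 3 + 4 * β - 3 * τ)]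
  constructor
  · intro h
    by_contra hc
    push Not at hc
    have : (7 - 4 * τ) * (τ - 1) ≤ 0 := by nlinarith
    linarith
  · intro h
    exact mul_pos (by linarith) (by linarith)

/-- `δpair < δR` always (same discriminant `β − (τ−1)² > 0`): a dream pair measure would improve on
Roy everywhere, but still not reach the edge for `τ < 7/4`. -/
theorem δpair_lt_δR (h1 : 1 < τ) (h2 : τ < 2) (hβ : τ < β) : δpair β τ < δR β τ := by
  unfold δpair δR
  have hA : (0:ℝ) < 3 + 4 * β - 3 * τ := by linarith
  have hB : (0:ℝ) < β + 1 - τ := by linarith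
  rw [div_lt_div_iff₀ hA hB]
  have hτ : 0 < τ - 1 := by linarith
  have key : (2 - τ) * (3 + 4 * β - 3 * τ) - (7 - 4 * τ) * (β + 1 - τ) = β - (τ - 1) ^ 2 := by ring
  have hpos : 0 < β - (τ - 1) ^ 2 := by nlinarith
  nlinarith [mul_pos hτ hpos, key]

/-- **(iii) The explicit one-pair Hermite–Padé / Liouville version never beats Roy:** its threshold
`δHP` exceeds `δR` (difference of cross-products `(τ−1)(β−1) > 0`). -/
theorem δR_lt_δHP (h1 : 1 < τ) (h2 : τ < 2) (hβ : τ < β) : δR β τ < δHP β τ := by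
  unfold δHP δR
  have hA : (0:ℝ) < 1 + 2 * β - τ := by linarith
  have hB : (0:ℝ) < β + 1 - τ := by linarith
  rw [div_lt_div_iff₀ hB hA]
  have hτ : 0 < τ - 1 := by linarith
  have key : (3 - τ) * (β + 1 - τ) - (2 - τ) * (1 + 2 * β - τ) = (τ - 1) * (β - 1) := by ring
  have hpos : 0 < (τ - 1) * (β - 1) := mul_pos hτ (by linarith)
  nlinarith [mul_pos hτ hpos, key]

/-- **(iv) Orbit-level exceptionality for every `δ ≥ 0`:** the Step-3 height exponent `b(1+β−τ)`
is always below the smallness exponent `β + δ` (difference `−((τ−1)² + δβ)/(τ−1)`), so the summed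
Step-2 closeness `D^{δ+β} deg Z` beats the orbit entropy `deg Z · h(Z) ≪ D^{e} · D^{b(1+β−τ)}`
by at least `D^{τ−1}`: the enemy CONFIGURATION is Diophantinely exceptional in the whole gap, but
only at the level of the orbit against the hypothesis polynomials — the currency of Roy's own
product-formula step, not of a pointwise transcendence measure. -/
theorem b_height_lt (h1 : 1 < τ) (hβ : τ < β) (hδ : 0 ≤ δ) : b τ δ * (1 + β - τ) < β + δ := by
  unfold b
  have hτ : 0 < τ - 1 := by linarith
  have hq : 0 ≤ δ / (τ - 1) := div_nonneg hδ hτ.le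
  have h1' : 0 < 1 + β - τ := by linarith
  nlinarith [mul_nonneg hq h1'.le]

/-- Numerical sanity instance `(τ, β) = (3/2, 2)`: `δR = 1/6`, `δcount = 0`, `δpair = 1/13`,
`δHP = 3/14`. -/
example : δR 2 (3/2) = 1/6 ∧ δcount 2 (3/2) = 0 ∧ δpair 2 (3/2) = 1/13 ∧ δHP 2 (3/2) = 3/14 := by
  unfold δR δcount δpair δHP
  norm_num

/-- Numerical sanity instance `(τ, β) = (5/4, 2)`: `δR = 3/28`, `δcount = 1/30`, `δpair = 2/29`. -/
example : δR 2 (5/4) = 3/28 ∧ δcount 2 (5/4) = 1/30 ∧ δpair 2 (5/4) = 2/29 := by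
  unfold δR δcount δpair
  norm_num

end CosetDifferenceExponents
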